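import Mathlib
import Summits.Ventures.PercRepro2.Defs
import Summits.Ventures.PercRepro2.DisagreementPinned
import Summits.Ventures.PercRepro2.TriDisagreement

/-!
# Pinned typed three-copy sums are weight-free typed 3-colouring counts
(blind cell PercRepro2, p1; `proofs/P1-TWOCOPY.md` §8)

With every edge off `F` pinned (`q e ∈ {0,1}`), the typed three-copy sum of `TriDisagreement.lean`
factors as

  `triSum q F τ K = (∏_{e ∈ F} q_e^{τ e} (1 − q_e)^{3 − τ e}) · typedCount F z τ K`,

`z` the pinned configuration and `typedCount F z τ K = ∑ K x y z'` over the triples that agree with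
`z` off `F` and have exactly `τ e` open copies at each `e ∈ F` ("typed 3-colourings" of the minor).
So the base hypothesis of `triSum_nonneg_of_pinned` is exactly the nonnegativity of these weight-free
counts (`triSum_nonneg_of_typedCount`) — the statement the census checks for the cubic kernel of the
covariance form (HCOV).
-/

namespace Summit.Ventures.PercRepro2

section TypedCount

variable {E : Type*} [Fintype E] [DecidableEq E] {R : Type*} [CommRing R]

/-- The weight-free typed count: triples agreeing with `z` off `F`, with open counts `τ` on `F`. -/
def typedCount (F : Finset E) (z : Config E) (τ : E → ℕ)
    (K : Config E → Config E → Config E → R) : R :=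
  ∑ x : Config E, ∑ y : Config E, ∑ w : Config E,
    if (∀ e, e ∉ F → x e = z e ∧ y e = z e ∧ w e = z e) ∧ (∀ e ∈ F, openCount x y w e = τ e)
      then K x y w else 0

omit [Fintype E] [DecidableEq E] in
/-- The three edge factors of an edge with `k` open copies multiply to `q^k (1 − q)^{3 − k}`. -/
lemma edgeFactor_three (q : R) (a b c : Bool) :
    edgeFactor q a * edgeFactor q b * edgeFactor q c =
      q ^ (a.toNat + b.toNat + c.toNat) * (1 - q) ^ (3 - (a.toNat + b.toNat + c.toNat)) := by
  cases a <;> cases b <;> cases c <;> simp [edgeFactor] <;> ring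

end TypedCount

section TriPinnedEval

variable {E : Type*} [Fintype E] [DecidableEq E] {R : Type*} [CommRing R] [Nontrivial R]
  [DecidableEq R]

/-- **Pinned evaluation of typed three-copy sums.** -/
theorem triSum_pinned_eq (q : E → R) (F : Finset E) (hq : ∀ e, e ∉ F → q e = 0 ∨ q e = 1)
    (τ : E → ℕ) (K : Config E → Config E → Config E → R) :
    triSum q F τ K =
      (∏ e ∈ F, q e ^ τ e * (1 - q e) ^ (3 - τ e)) * typedCount F (pinnedConfig q) τ K := by
  unfold triSum typedCount
  simp only [Finset.mul_sum]
  refine Finset.sum_congr rfl fun x _ => ?_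
  refine Finset.sum_congr rfl fun y _ => ?_
  refine Finset.sum_congr rfl fun w _ => ?_
  by_cases hF : ∀ e ∈ F, openCount x y w e = τ e
  · rw [if_pos hF]
    rw [weight_eq_of_pinned q F hq x, weight_eq_of_pinned q F hq y, weight_eq_of_pinned q F hq w]
    by_cases hagree : ∀ e, e ∉ F → x e = pinnedConfig q e ∧ y e = pinnedConfig q e ∧
        w e = pinnedConfig q e
    · have hx : ∀ e, e ∉ F → x e = pinnedConfig q e := fun e he => (hagree e he).1
      have hy : ∀ e, e ∉ F → y e = pinnedConfig q e := fun e he => (hagree e he).2.1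
      have hw : ∀ e, e ∉ F → w e = pinnedConfig q e := fun e he => (hagree e he).2.2
      rw [if_pos hx, if_pos hy, if_pos hw]
      rw [if_pos (show (∀ e, e ∉ F → x e = pinnedConfig q e ∧ y e = pinnedConfig q e ∧
          w e = pinnedConfig q e) ∧ (∀ e ∈ F, openCount x y w e = τ e) from ⟨hagree, hF⟩)]
      have hprod : (∏ e ∈ F, edgeFactor (q e) (x e)) * (∏ e ∈ F, edgeFactor (q e) (y e)) *
          (∏ e ∈ F, edgeFactor (q e) (w e)) = ∏ e ∈ F, q e ^ τ e * (1 - q e) ^ (3 - τ e) := by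
        rw [← Finset.prod_mul_distrib, ← Finset.prod_mul_distrib]
        refine Finset.prod_congr rfl fun e he => ?_
        rw [edgeFactor_three]
        have := hF e he
        unfold openCount at this
        rw [this]
      calc (∏ e ∈ F, edgeFactor (q e) (x e)) * 1 * ((∏ e ∈ F, edgeFactor (q e) (y e)) * 1) *
            ((∏ e ∈ F, edgeFactor (q e) (w e)) * 1) * K x y w
          = ((∏ e ∈ F, edgeFactor (q e) (x e)) * (∏ e ∈ F, edgeFactor (q e) (y e)) *
              (∏ e ∈ F, edgeFactor (q e) (w e))) * K x y w := by ring
        _ = (∏ e ∈ F, q e ^ τ e * (1 - q e) ^ (3 - τ e)) * K x y w := by rw [hprod]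
    · have hbig : ¬ ((∀ e, e ∉ F → x e = pinnedConfig q e ∧ y e = pinnedConfig q e ∧
          w e = pinnedConfig q e) ∧ (∀ e ∈ F, openCount x y w e = τ e)) := fun h => hagree h.1
      rw [if_neg hbig, mul_zero]
      -- some copy disagrees with the pinned configuration off `F`: its weight indicator vanishes
      rw [not_forall] at hagree
      obtain ⟨e, he⟩ := hagree
      rw [Classical.not_imp] at he
      obtain ⟨he, hne⟩ := he
      rw [not_and_or, not_and_or] at hne
      rcases hne with hne | hne | hne
      · rw [if_neg (show ¬ (∀ e, e ∉ F → x e = pinnedConfig q e) from fun h => hne (h e he))]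
        ring
      · rw [if_neg (show ¬ (∀ e, e ∉ F → y e = pinnedConfig q e) from fun h => hne (h e he))]
        ring
      · rw [if_neg (show ¬ (∀ e, e ∉ F → w e = pinnedConfig q e) from fun h => hne (h e he))]
        ring
  · rw [if_neg hF, if_neg (fun h => hF h.2), mul_zero]

end TriPinnedEval

section TriReduction

variable {E : Type*} [Fintype E] [DecidableEq E] {R : Type*} [CommRing R] [LinearOrder R]
  [IsStrictOrderedRing R]

omit [Fintype E] [DecidableEq E] in
/-- The `F`-factors of a weight vector with values in `[0, 1]` are nonnegative. -/
lemma prod_typed_factors_nonneg (q : E → R) (hq : ∀ e, 0 ≤ q e ∧ q e ≤ 1) (F : Finset E)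
    (τ : E → ℕ) : 0 ≤ ∏ e ∈ F, q e ^ τ e * (1 - q e) ^ (3 - τ e) :=
  Finset.prod_nonneg fun e _ =>
    mul_nonneg (pow_nonneg (hq e).1 _) (pow_nonneg (sub_nonneg.mpr (hq e).2) _)

/-- **Reduction to typed 3-colouring counts**: if `typedCount F z τ K ≥ 0` for every minor `(F, z)`
and every type map with values in `{1, 2}` on `F`, then every typed three-copy sum — in particular
the cubic form `triSum p ∅ τ K` — is nonnegative for every weight vector with values in `[0, 1]`. -/
theorem triSum_nonneg_of_typedCount (K : Config E → Config E → Config E → R)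
    (hcount : ∀ (F : Finset E) (z : Config E) (τ : E → ℕ), (∀ e ∈ F, τ e = 1 ∨ τ e = 2) →
      0 ≤ typedCount F z τ K)
    (p : E → R) (hp : ∀ e, 0 ≤ p e ∧ p e ≤ 1) (F : Finset E) (τ : E → ℕ)
    (hτ : ∀ e ∈ F, τ e = 1 ∨ τ e = 2) : 0 ≤ triSum p F τ K := by
  refine triSum_nonneg_of_pinned K (fun q G σ hq hpin hσ => ?_) p hp F τ hτ
  rw [triSum_pinned_eq q G hpin σ K]
  exact mul_nonneg (prod_typed_factors_nonneg q hq G σ) (hcount G (pinnedConfig q) σ hσ)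

end TriReduction

end Summit.Ventures.PercRepro2
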